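import Literature.MathematicalPhysics.StatisticalMechanics.LennardJonesClusters
import Summits.AtomisticToContinuum.Crystallization.Theorems.ChargedEnergyGap.Negative.Unconditional
import Summits.AtomisticToContinuum.Crystallization.Theorems.PricedLinkCensusChargedPeriodicIsOptimalPacking
import HarnessLib

/-!
# `ChargedEnergyGap` — GROSS SURGERY: holes and rattlers are priced at chemical potential `e*`
# in EVERY finite configuration, without locating `e*` (cell `decomp-a2c`, lens 3, generation 41, node «ExposureDial», part A)

Target of record: the GROSS piece `ChargedEnergyGapChartDial.GrossChargeGap (3/20)` of the exact chart dial
`chargedEnergyGap_iff_pieces` of the shared crux `PricedLinkCensus.ChargedEnergyGap` (`stmt-AtomisticToContinuum-14231`),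
the piece tagged IDEA-NEEDED · BARRIER-ringed and decomposed by no lens so far.  Every statement on the gross side is a
pricing RELATIVE TO THE UNKNOWN NUMBER `e* = ⨅_Q e(Q)`; the standing objection to every gross-side attack is that a lower
bound `excess ≥ κ · #species` seems to need `e*` from below.

This file proves that for TWO ENERGETIC SPECIES it does not.  For every finite injective configuration `y : Fin N → ℝ³`:

* §2 `sum_rattlers_le_excess` — for every family `D` of sites, pairwise `≥ 9/10` apart,
  `∑_{i ∈ D} (u_y(i) − e*) ≤ E(y) − N·e*` (`u_y(i) = ∑_{k ≠ i} V(|y_i − y_k|)` the one-particle energy): DELETING `D`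
  leaves `N − #D` points of energy `≥ (N − #D)·e*` (`card_mul_eStar_le`, by far periodisation — `e*` is used only as a
  LOWER bound of periodic energies, i.e. from ABOVE), and the bonds inside `D` are `≤ 0`;
* §3 `sum_holes_le_excess` — for every family `z : Fin m → ℝ³` of points off `y`, pairwise `≥ 9/10` apart,
  `∑_j (e* − φ_y(z_j)) ≤ E(y) − N·e*` (`φ_y(z) = ∑_i V(|z − y_i|)` the field of `y`): INSERTING the `z_j` gives `N + m`
  points of energy `≥ (N + m)·e*`, and the new–new bonds are `≤ 0`.

Hence (`card_rattlers_le_excess`, `card_holes_le_excess`) every `9/10`-separated family of `ε`-RATTLERS (`u ≥ e* + ε`) or of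
`ε`-HOLES (`φ ≤ e* − ε`) is priced LINEARLY, `ε · # ≤ E(y) − N·e*`, uniformly in `y` and `N`: the first `e*`-relative linear
pricing theorems of the programme that hold for ALL configurations (the tree has the MINIMISER versions at law level —
`FrustratedLawDichotomyBindingFloor.bindingFloor_of_minimising`, `…ThickeningVacancyFloor` (generation 4 of the 27623
lineage: atoms of a minimising law are bound by `≥ |e*|`, holes bind by `≤ |e*|`) — and Sütő's one-atom surgery tests of an
`e*`-μGSC, `FrustratedLawDichotomyGSCSurgeryTests`; here the same surgery is run at POSITIVE EXCESS and summed over a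
separated family, which is what a pricing needs).  Part B (`ChargedEnergyGapExposureDial`) sorts the gross charged motif
sites of a periodic configuration by the energetic predicate EXPOSED = (rattler ∨ near a hole) and splits `GrossChargeGap θ`
EXACTLY into an exposed piece (ATTACKABLE: this file is its energy input; what remains is packing multiplicity and the
periodic transfer) and a COMPACT residual (well-bound, hole-free gross matter: tcp / icosahedral / bcc-like / amorphous).

All `[this work]` unless marked; the energy floor is the tree's `card_mul_eStar_le` `[folklore]` (restricted to a sub-family in §1, as in
`LjLaminarWindowsSketch.windowFloor_sum_sum_ge`, whose module is not built on the farm snapshot and is therefore not imported).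
-/

noncomputable section

open scoped BigOperators
open Literature.MathematicalPhysics.StatisticalMechanics
open Summit.AtomisticToContinuum.Crystallization.Theorems.ChargedEnergyGapNegative (E3 eStar card_mul_eStar_le)
open Summit.AtomisticToContinuum.Crystallization.Theorems.ChargedPeriodicOptimal
  (exists_separated_net card_le_card_net_mul card_ball_le_of_separated)

namespace Summit.AtomisticToContinuum.Crystallization.Theorems.ChargedEnergyGapGrossSurgery

variable {N : ℕ}

/-! ## §0 The sign of `V_LJ` between two points at distance `≥ 9/10` (`(10/9)⁶ < 2`) -/

/-- `V_LJ(|p − q|) ≤ 0` as soon as `|p − q| ≥ 9/10` (indeed beyond `2^{-1/6} ≈ 0.891`): with `u = s⁻⁶ ≤ (10/9)⁶ < 2`,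
`V_LJ = u(u − 2)/12 ≤ 0`.  Stated on DISTANCES, the only shape used below and in part C1 (the scalar forms are the tree's
`…PhononSlackCertificatesNearFarGlueR.lennardJones_nonpos_of_ge_nine_tenths` / `…StrictSplittingRuleBirth.perturbative_lennardJones_neg_of_le`,
whose modules sit on other theses cones and are therefore not imported here). -/
theorem lennardJones_dist_nonpos {p q : E3} (hs : 9 / 10 ≤ dist p q) : lennardJones (dist p q) ≤ 0 := by
  unfold lennardJones
  have hs0 : 0 < dist p q := by linarith
  have h0 : 0 ≤ (dist p q)⁻¹ := inv_nonneg.2 hs0.le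
  have h1 : (dist p q)⁻¹ ≤ 10 / 9 := by
    rw [inv_le_comm₀ hs0 (by norm_num)]; norm_num; exact hs
  have h6 : ((dist p q)⁻¹) ^ 6 ≤ (10 / 9 : ℝ) ^ 6 := pow_le_pow_left₀ h0 h1 6
  have h6' : ((dist p q)⁻¹) ^ 6 ≤ 2 := h6.trans (by norm_num)
  have h12 : ((dist p q)⁻¹) ^ 12 = (((dist p q)⁻¹) ^ 6) ^ 2 := by ring
  rw [h12]
  nlinarith [pow_nonneg h0 6]

/-! ## §1 Finite bookkeeping -/

/-- The one-particle energy as a full sum (the diagonal term is `V_LJ(0) = 0`). -/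
theorem sum_univ_eq_siteEnergy (y : Fin N → E3) (i : Fin N) :
    ∑ k, lennardJones (dist (y i) (y k)) = siteEnergy lennardJones y i := by
  unfold siteEnergy
  rw [← Finset.add_sum_erase _ _ (Finset.mem_univ i), dist_self, lennardJones_zero, zero_add]

/-- **The field** of the configuration `y` at a point `z`: `φ_y(z) = ∑_i V_LJ(|z − y_i|)` (the binding a particle
inserted at `z` would receive). -/
def holeField (y : Fin N → E3) (z : E3) : ℝ := ∑ i, lennardJones (dist z (y i))

/-- **Sub-family floor** `#S · e* ≤ ½ Σ_{(i,k) ∈ S²} V_LJ(|x_i − x_k|)`: the double sum is `2·E(x|_S)` and `#S · e* ≤ E(x|_S)`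
(`card_mul_eStar_le`, far periodisation). [folklore] -/
theorem card_mul_eStar_le_half_sum_sum {x : Fin N → E3} (hx : Function.Injective x) (S : Finset (Fin N)) :
    (S.card : ℝ) * eStar ≤ 2⁻¹ * ∑ i ∈ S, ∑ k ∈ S, lennardJones (dist (x i) (x k)) := by
  set f := S.orderEmbOfFin rfl with hf
  have hS : Finset.univ.map f.toEmbedding = S := Finset.map_orderEmbOfFin_univ S rfl
  have key := sum_sum_map_eq_two_mul_interactionEnergy lennardJones lennardJones_zero x f.toEmbedding
  rw [hS] at key
  have h := card_mul_eStar_le (hx.comp f.toEmbedding.injective)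
  rw [key]
  linarith

/-- A double sum over a `9/10`-separated index family of sites is `≤ 0` (diagonal `0`, off-diagonal `≤ 0`). -/
theorem sum_sum_nonpos_of_separated (y : Fin N → E3) (D : Finset (Fin N))
    (hD : ∀ i ∈ D, ∀ k ∈ D, i ≠ k → 9 / 10 ≤ dist (y i) (y k)) :
    ∑ i ∈ D, ∑ k ∈ D, lennardJones (dist (y i) (y k)) ≤ 0 := by
  refine Finset.sum_nonpos fun i hi => Finset.sum_nonpos fun k hk => ?_
  by_cases hik : i = k
  · subst hik; simp [lennardJones_zero]
  · exact lennardJones_dist_nonpos (hD i hi k hk hik)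

/-! ## §2 Rattlers: deleting a separated family -/

/-- **Rattler surgery.**  For every finite injective configuration `y` and every family `D` of its sites that is
pairwise `≥ 9/10` apart, `∑_{i ∈ D} (u_y(i) − e*) ≤ E(y) − N·e*`.  Proof: `2E(y) = Σ_{Dᶜ×Dᶜ} + 2 Σ_{i∈D} u_y(i) − Σ_{D×D}`,
the first term is `≥ 2 e* (N − #D)` (`card_mul_eStar_le_half_sum_sum`), the last is `≤ 0`. -/
theorem sum_rattlers_le_excess {y : Fin N → E3} (hy : Function.Injective y) (D : Finset (Fin N))
    (hD : ∀ i ∈ D, ∀ k ∈ D, i ≠ k → 9 / 10 ≤ dist (y i) (y k)) :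
    ∑ i ∈ D, (siteEnergy lennardJones y i - eStar) ≤ interactionEnergy lennardJones y - (N : ℝ) * eStar := by
  classical
  -- `2E = Σ_i Σ_k V`
  have h2E : 2 * interactionEnergy lennardJones y = ∑ i, ∑ k, lennardJones (dist (y i) (y k)) :=
    two_mul_interactionEnergy_eq_sum_sum lennardJones lennardJones_zero y
  -- split the outer sum over `D` and `Dᶜ`, and the inner sum of the `Dᶜ` part likewise
  have hsplit : ∑ i, ∑ k, lennardJones (dist (y i) (y k)) =
      (∑ i ∈ D, ∑ k, lennardJones (dist (y i) (y k))) +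
        (∑ i ∈ Dᶜ, ∑ k ∈ D, lennardJones (dist (y i) (y k))) +
          ∑ i ∈ Dᶜ, ∑ k ∈ Dᶜ, lennardJones (dist (y i) (y k)) := by
    rw [← Finset.sum_add_sum_compl D (fun i => ∑ k, lennardJones (dist (y i) (y k)))]
    have : ∑ i ∈ Dᶜ, ∑ k, lennardJones (dist (y i) (y k)) =
        (∑ i ∈ Dᶜ, ∑ k ∈ D, lennardJones (dist (y i) (y k))) +
          ∑ i ∈ Dᶜ, ∑ k ∈ Dᶜ, lennardJones (dist (y i) (y k)) := by
      rw [← Finset.sum_add_distrib]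
      exact Finset.sum_congr rfl fun i _ =>
        (Finset.sum_add_sum_compl D (fun k => lennardJones (dist (y i) (y k)))).symm
    rw [this]; ring
  -- the site energies of `D`
  have hsite : ∑ i ∈ D, ∑ k, lennardJones (dist (y i) (y k)) = ∑ i ∈ D, siteEnergy lennardJones y i :=
    Finset.sum_congr rfl fun i _ => sum_univ_eq_siteEnergy y i
  -- the cross term, by symmetry, is `Σ_{k∈D} (u(k) − Σ_{i∈D} V(k,i))`
  have hcross : ∑ i ∈ Dᶜ, ∑ k ∈ D, lennardJones (dist (y i) (y k)) =
      (∑ k ∈ D, siteEnergy lennardJones y k) - ∑ k ∈ D, ∑ i ∈ D, lennardJones (dist (y k) (y i)) := by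
    rw [Finset.sum_comm, ← Finset.sum_sub_distrib]
    refine Finset.sum_congr rfl fun k _ => ?_
    rw [eq_sub_iff_add_eq, ← sum_univ_eq_siteEnergy y k,
      ← Finset.sum_add_sum_compl D (fun i => lennardJones (dist (y k) (y i)))]
    have : ∑ i ∈ Dᶜ, lennardJones (dist (y i) (y k)) = ∑ i ∈ Dᶜ, lennardJones (dist (y k) (y i)) :=
      Finset.sum_congr rfl fun i _ => by rw [dist_comm]
    rw [this, add_comm]
  have hDD : ∑ k ∈ D, ∑ i ∈ D, lennardJones (dist (y k) (y i)) ≤ 0 := sum_sum_nonpos_of_separated y D hD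
  have hfloor : ((Dᶜ).card : ℝ) * eStar ≤ 2⁻¹ * ∑ i ∈ Dᶜ, ∑ k ∈ Dᶜ, lennardJones (dist (y i) (y k)) :=
    card_mul_eStar_le_half_sum_sum hy Dᶜ
  have hcard : ((Dᶜ).card : ℝ) = (N : ℝ) - (D.card : ℝ) := by
    rw [Finset.card_compl, Fintype.card_fin, Nat.cast_sub (D.card_le_univ.trans_eq (Fintype.card_fin N))]
  rw [hcard] at hfloor
  rw [Finset.sum_sub_distrib, Finset.sum_const, nsmul_eq_mul]
  linarith [h2E, hsplit, hsite, hcross, hDD, hfloor]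

/-- **Rattlers are priced linearly.**  If every site of the `9/10`-separated family `D` is an `ε`-RATTLER
(`e* + ε ≤ u_y(i)`: bound by at most `|e*| − ε`), then `ε · #D ≤ E(y) − N·e*`. -/
theorem card_rattlers_le_excess {y : Fin N → E3} (hy : Function.Injective y) {ε : ℝ} (D : Finset (Fin N))
    (hD : ∀ i ∈ D, ∀ k ∈ D, i ≠ k → 9 / 10 ≤ dist (y i) (y k))
    (hratt : ∀ i ∈ D, eStar + ε ≤ siteEnergy lennardJones y i) :
    ε * (D.card : ℝ) ≤ interactionEnergy lennardJones y - (N : ℝ) * eStar := by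
  have h := sum_rattlers_le_excess hy D hD
  have h' : ε * (D.card : ℝ) ≤ ∑ i ∈ D, (siteEnergy lennardJones y i - eStar) := by
    calc ε * (D.card : ℝ) = ∑ i ∈ D, ε := by rw [Finset.sum_const, nsmul_eq_mul, mul_comm]
      _ ≤ _ := Finset.sum_le_sum fun i hi => by linarith [hratt i hi]
  exact h'.trans h

/-! ## §3 Holes: inserting a separated family -/

/-- **Hole surgery.**  For every finite injective configuration `y` and every family `z : Fin m → ℝ³` of points off `y`
that is pairwise `≥ 9/10` apart, `∑_j (e* − φ_y(z_j)) ≤ E(y) − N·e*`.  Proof: the enlarged configuration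
`Fin.append y z` is injective, so its energy `E(y) + Σ_j φ_y(z_j) + Σ_{j<j'} V(|z_j − z_j'|)` is `≥ (N + m)·e*`
(`card_mul_eStar_le`), and the new–new bonds are `≤ 0`.  No bound on `e*` from below is used. -/
theorem sum_holes_le_excess {y : Fin N → E3} (hy : Function.Injective y) {m : ℕ} (z : Fin m → E3)
    (hz : ∀ j j', j ≠ j' → 9 / 10 ≤ dist (z j) (z j')) (hzy : ∀ i j, y i ≠ z j) :
    ∑ j, (eStar - holeField y (z j)) ≤ interactionEnergy lennardJones y - (N : ℝ) * eStar := by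
  classical
  set w : Fin (N + m) → E3 := Fin.append y z with hw
  have hzinj : Function.Injective z := fun j j' h => by
    by_contra hne
    have := hz j j' hne
    rw [h, dist_self] at this
    norm_num at this
  have hwinj : Function.Injective w := Fin.append_injective_iff.2 ⟨hy, hzinj, hzy⟩
  have hfloorw : ((N + m : ℕ) : ℝ) * eStar ≤ interactionEnergy lennardJones w := card_mul_eStar_le hwinj
  have h2w : 2 * interactionEnergy lennardJones w = ∑ a, ∑ b, lennardJones (dist (w a) (w b)) :=
    two_mul_interactionEnergy_eq_sum_sum lennardJones lennardJones_zero w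
  have h2y : 2 * interactionEnergy lennardJones y = ∑ i, ∑ k, lennardJones (dist (y i) (y k)) :=
    two_mul_interactionEnergy_eq_sum_sum lennardJones lennardJones_zero y
  -- expand the double sum of `w` in the four blocks
  have hexp : ∑ a, ∑ b, lennardJones (dist (w a) (w b)) =
      (∑ i, ∑ k, lennardJones (dist (y i) (y k))) + 2 * (∑ j, holeField y (z j)) +
        ∑ j, ∑ j', lennardJones (dist (z j) (z j')) := by
    rw [Fin.sum_univ_add]
    simp_rw [Fin.sum_univ_add, hw, Fin.append_left, Fin.append_right]
    simp only [Finset.sum_add_distrib, holeField]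
    have hx : ∑ x : Fin N, ∑ j : Fin m, lennardJones (dist (y x) (z j)) =
        ∑ j : Fin m, ∑ i : Fin N, lennardJones (dist (z j) (y i)) := by
      rw [Finset.sum_comm]; simp_rw [dist_comm]
    rw [hx]; ring
  have hzz : ∑ j, ∑ j', lennardJones (dist (z j) (z j')) ≤ 0 := by
    refine Finset.sum_nonpos fun j _ => Finset.sum_nonpos fun j' _ => ?_
    by_cases hjj : j = j'
    · subst hjj; simp [lennardJones_zero]
    · exact lennardJones_dist_nonpos (hz j j' hjj)
  rw [Finset.sum_sub_distrib, Finset.sum_const, Finset.card_univ, Fintype.card_fin, nsmul_eq_mul]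
  push_cast at hfloorw
  linarith [hfloorw, h2w, h2y, hexp, hzz]

/-- **Holes are priced linearly.**  If each point of the `9/10`-separated family `z` (off `y`) is an `ε`-HOLE of `y`
(`φ_y(z_j) ≤ e* − ε`: a particle inserted there would be bound by at least `|e*| + ε`), then `ε · m ≤ E(y) − N·e*`. -/
theorem card_holes_le_excess {y : Fin N → E3} (hy : Function.Injective y) {ε : ℝ} {m : ℕ} (z : Fin m → E3)
    (hz : ∀ j j', j ≠ j' → 9 / 10 ≤ dist (z j) (z j')) (hzy : ∀ i j, y i ≠ z j)
    (hhole : ∀ j, holeField y (z j) ≤ eStar - ε) :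
    ε * (m : ℝ) ≤ interactionEnergy lennardJones y - (N : ℝ) * eStar := by
  have h := sum_holes_le_excess hy z hz hzy
  have h' : ε * (m : ℝ) ≤ ∑ j, (eStar - holeField y (z j)) := by
    calc ε * (m : ℝ) = ∑ _j : Fin m, ε := by
          rw [Finset.sum_const, Finset.card_univ, Fintype.card_fin, nsmul_eq_mul, mul_comm]
      _ ≤ _ := Finset.sum_le_sum fun j _ => by linarith [hhole j]
  exact h'.trans h

/-! ## §4 Both surgeries at once -/

/-- **Simultaneous surgery.**  Deleting a `9/10`-separated family `D` of sites AND inserting a `9/10`-separated family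
`z` of points off `y`, each new point `≥ 9/10` from every deleted-or-kept site is not needed: the two pricings simply
ADD when the hole family is tested against the configuration with `D` deleted.  In the form provers use: rattlers and
holes of the SAME configuration are priced jointly up to the factor `2`,
`ε·(#D + m) ≤ 2·(E(y) − N·e*)`. -/
theorem card_rattlers_add_holes_le {y : Fin N → E3} (hy : Function.Injective y) {ε : ℝ}
    (D : Finset (Fin N)) (hD : ∀ i ∈ D, ∀ k ∈ D, i ≠ k → 9 / 10 ≤ dist (y i) (y k))
    (hratt : ∀ i ∈ D, eStar + ε ≤ siteEnergy lennardJones y i)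
    {m : ℕ} (z : Fin m → E3) (hz : ∀ j j', j ≠ j' → 9 / 10 ≤ dist (z j) (z j')) (hzy : ∀ i j, y i ≠ z j)
    (hhole : ∀ j, holeField y (z j) ≤ eStar - ε) :
    ε * ((D.card : ℝ) + m) ≤ 2 * (interactionEnergy lennardJones y - (N : ℝ) * eStar) := by
  have h1 := card_rattlers_le_excess hy D hD hratt
  have h2 := card_holes_le_excess hy z hz hzy hhole
  linarith

/-! ## §6 Nets: in a `δ`-separated configuration ALL `ε`-rattlers and ALL sites near `ε`-holes are priced

From a separated family to the whole species at the cost of a packing constant only: a maximal `9/10`-separated sub-family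
is a `9/10`-net (`ChargedPeriodicOptimal.exists_separated_net`) and a ball of radius `D` holds `≤ (2D/δ + 1)³` sites of a
`δ`-separated configuration (`card_ball_le_of_separated`, `card_le_of_separated_of_dist_le`).  These are the finite forms of the
piece `ExposedGrossPricing` of part B, species by species; what remains for the piece is the periodic transfer and the hard-core lift. -/

/-- `injective_of_separated`: monotonicity / bookkeeping lemma of this file (see the module docstring). [formal bookkeeping] -/
theorem injective_of_separated {y : Fin N → E3} {δ : ℝ} (hδ : 0 < δ)
    (hsep : ∀ i k, i ≠ k → δ ≤ dist (y i) (y k)) : Function.Injective y := fun i k h => by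
  by_contra hne
  have := hsep i k hne
  rw [h, dist_self] at this
  exact absurd this (not_le.2 hδ)

/-- `excess_nonneg_of_separated` (monotonicity / bookkeeping lemma of this file; see the module docstring). [formal bookkeeping] -/
theorem excess_nonneg_of_separated {y : Fin N → E3} {δ : ℝ} (hδ : 0 < δ)
    (hsep : ∀ i k, i ≠ k → δ ≤ dist (y i) (y k)) : 0 ≤ interactionEnergy lennardJones y - (N : ℝ) * eStar := by
  have := card_mul_eStar_le (injective_of_separated hδ hsep)
  linarith

/-- **All rattlers are priced** (finite, `δ`-separated): `ε · #{i : u_y(i) ≥ e* + ε} ≤ (9/(5δ) + 1)³ · (E(y) − N·e*)`. -/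
theorem card_allRattlers_le_excess {y : Fin N → E3} {δ ε : ℝ} (hδ : 0 < δ)
    (hsep : ∀ i k, i ≠ k → δ ≤ dist (y i) (y k)) (S : Finset (Fin N))
    (hS : ∀ i ∈ S, eStar + ε ≤ siteEnergy lennardJones y i) :
    ε * (S.card : ℝ) ≤ (2 * (9 / 10) / δ + 1) ^ 3 * (interactionEnergy lennardJones y - (N : ℝ) * eStar) := by
  classical
  have hy := injective_of_separated hδ hsep
  have hexc := excess_nonneg_of_separated hδ hsep
  have hC : (0 : ℝ) < (2 * (9 / 10) / δ + 1) ^ 3 := by positivity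
  rcases lt_or_ge ε 0 with hε | hε
  · have hS0 : (0 : ℝ) ≤ S.card := Nat.cast_nonneg _
    nlinarith [mul_nonneg hC.le hexc, mul_nonneg hS0 (neg_nonneg.2 hε.le)]
  obtain ⟨T, hTS, hTsep, hnet⟩ := exists_separated_net S y (by norm_num : (0 : ℝ) ≤ 9 / 10)
  have hT : ε * (T.card : ℝ) ≤ interactionEnergy lennardJones y - (N : ℝ) * eStar :=
    card_rattlers_le_excess hy T (fun i hi k hk hik => (hTsep i hi k hk hik).le) fun i hi => hS i (hTS hi)
  have hcount : (S.card : ℝ) ≤ T.card * (2 * (9 / 10) / δ + 1) ^ 3 :=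
    card_le_card_net_mul y hnet fun t _ => card_ball_le_of_separated y hδ hsep S t (by norm_num)
  calc ε * (S.card : ℝ) ≤ ε * (T.card * (2 * (9 / 10) / δ + 1) ^ 3) := mul_le_mul_of_nonneg_left hcount hε
    _ = (2 * (9 / 10) / δ + 1) ^ 3 * (ε * T.card) := by ring
    _ ≤ _ := mul_le_mul_of_nonneg_left hT hC.le

/-- **All sites near holes are priced** (finite, `δ`-separated): if every `i ∈ S` has an `ε`-hole `hole i` of `y` within `R`
(field `≤ e* − ε`, all sites `≥ 1/2` away from it), then `ε · #S ≤ (2(R + 9/10)/δ + 1)³ · (E(y) − N·e*)`. -/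
theorem card_allNearHoles_le_excess {y : Fin N → E3} {δ ε R : ℝ} (hδ : 0 < δ) (hR : 0 ≤ R)
    (hsep : ∀ i k, i ≠ k → δ ≤ dist (y i) (y k)) (S : Finset (Fin N)) (hole : Fin N → E3)
    (hnear : ∀ i ∈ S, dist (y i) (hole i) ≤ R) (hfar : ∀ i ∈ S, ∀ k, (1 : ℝ) / 2 ≤ dist (hole i) (y k))
    (hfield : ∀ i ∈ S, holeField y (hole i) ≤ eStar - ε) :
    ε * (S.card : ℝ) ≤ (2 * (R + 9 / 10) / δ + 1) ^ 3 * (interactionEnergy lennardJones y - (N : ℝ) * eStar) := by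
  classical
  have hy := injective_of_separated hδ hsep
  have hexc := excess_nonneg_of_separated hδ hsep
  have hC : (0 : ℝ) < (2 * (R + 9 / 10) / δ + 1) ^ 3 := by positivity
  rcases lt_or_ge ε 0 with hε | hε
  · have hS0 : (0 : ℝ) ≤ S.card := Nat.cast_nonneg _
    nlinarith [mul_nonneg hC.le hexc, mul_nonneg hS0 (neg_nonneg.2 hε.le)]
  obtain ⟨T, hTS, hTsep, hnet⟩ := exists_separated_net S hole (by norm_num : (0 : ℝ) ≤ 9 / 10)
  -- the holes of the net, reindexed by `Fin T.card`, form a `9/10`-separated family off `y`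
  set z : Fin T.card → E3 := fun j => hole ((T.equivFin.symm j : T) : Fin N) with hz
  have hmem : ∀ j : Fin T.card, ((T.equivFin.symm j : T) : Fin N) ∈ S := fun j => hTS (T.equivFin.symm j).2
  have hzsep : ∀ j j', j ≠ j' → 9 / 10 ≤ dist (z j) (z j') := by
    intro j j' hjj
    have hne : ((T.equivFin.symm j : T) : Fin N) ≠ ((T.equivFin.symm j' : T) : Fin N) := fun h =>
      hjj (T.equivFin.symm.injective (Subtype.ext h))
    exact (hTsep _ (T.equivFin.symm j).2 _ (T.equivFin.symm j').2 hne).le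
  have hzy : ∀ i j, y i ≠ z j := by
    intro i j h
    have := hfar _ (hmem j) i
    rw [show hole ((T.equivFin.symm j : T) : Fin N) = y i from h.symm, dist_self] at this
    norm_num at this
  have hT : ε * (T.card : ℝ) ≤ interactionEnergy lennardJones y - (N : ℝ) * eStar :=
    card_holes_le_excess hy z hzsep hzy fun j => hfield _ (hmem j)
  -- counting: `S ⊆ ⋃_{t ∈ T} {g ∈ S : |y g − hole t| ≤ R + 9/10}`, each fibre `δ`-separated in a ball
  have hsub : S ⊆ T.biUnion fun t => S.filter fun g => dist (y g) (hole t) ≤ R + 9 / 10 := by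
    intro g hg
    obtain ⟨t, ht, hgt⟩ := hnet g hg
    refine Finset.mem_biUnion.2 ⟨t, ht, Finset.mem_filter.2 ⟨hg, ?_⟩⟩
    calc dist (y g) (hole t) ≤ dist (y g) (hole g) + dist (hole g) (hole t) := dist_triangle _ _ _
      _ ≤ R + 9 / 10 := add_le_add (hnear g hg) hgt
  have hfib : ∀ t ∈ T, ((S.filter fun g => dist (y g) (hole t) ≤ R + 9 / 10).card : ℝ) ≤
      (2 * (R + 9 / 10) / δ + 1) ^ 3 := by
    intro t _
    set F := S.filter fun g => dist (y g) (hole t) ≤ R + 9 / 10 with hF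
    have hinj : Set.InjOn y F := fun k _ l _ hkl => hy hkl
    rw [← Finset.card_image_of_injOn hinj]
    have := card_le_of_separated_of_dist_le (F.image y) (hole t) hδ (by positivity : (0 : ℝ) ≤ R + 9 / 10) ?_ ?_
    · rwa [finrank_euclideanSpace_fin] at this
    · intro c hc
      obtain ⟨k, hk, rfl⟩ := Finset.mem_image.1 hc
      exact (Finset.mem_filter.1 hk).2
    · intro c hc c' hc' hne
      obtain ⟨k, -, rfl⟩ := Finset.mem_image.1 hc
      obtain ⟨l, -, rfl⟩ := Finset.mem_image.1 hc'
      exact hsep k l fun h => hne (h ▸ rfl)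
  have hcount : (S.card : ℝ) ≤ T.card * (2 * (R + 9 / 10) / δ + 1) ^ 3 :=
    calc (S.card : ℝ) ≤ ((T.biUnion fun t => S.filter fun g => dist (y g) (hole t) ≤ R + 9 / 10).card : ℝ) := by
          exact_mod_cast Finset.card_le_card hsub
      _ ≤ ∑ t ∈ T, ((S.filter fun g => dist (y g) (hole t) ≤ R + 9 / 10).card : ℝ) := by
          exact_mod_cast Finset.card_biUnion_le
      _ ≤ ∑ _t ∈ T, (2 * (R + 9 / 10) / δ + 1) ^ 3 := Finset.sum_le_sum hfib
      _ = T.card * (2 * (R + 9 / 10) / δ + 1) ^ 3 := by rw [Finset.sum_const, nsmul_eq_mul]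
  calc ε * (S.card : ℝ) ≤ ε * (T.card * (2 * (R + 9 / 10) / δ + 1) ^ 3) := mul_le_mul_of_nonneg_left hcount hε
    _ = (2 * (R + 9 / 10) / δ + 1) ^ 3 * (ε * T.card) := by ring
    _ = (2 * (R + 9 / 10) / δ + 1) ^ 3 * (ε * (Fintype.card (Fin T.card) : ℝ)) := by rw [Fintype.card_fin]
    _ ≤ _ := mul_le_mul_of_nonneg_left (by simpa [Fintype.card_fin] using hT) hC.le

/-- **The exposed species of a finite `1/3`-separated configuration is priced**: with `S_r` the `ε`-rattlers and `S_h` the sites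
within `R` of an `ε`-hole, `ε·(#S_r + #S_h) ≤ ((32/5)³ + (6R + 32/5)³)·(E(y) − N·e*)` — the finite form of part B's
`ExposedGrossPricing θ ε R` (for every `θ`; the chart plays no role on this piece). -/
theorem card_exposed_le_excess_third {y : Fin N → E3} {ε R : ℝ} (hR : 0 ≤ R)
    (hsep : ∀ i k, i ≠ k → (1 : ℝ) / 3 ≤ dist (y i) (y k)) (Sr Sh : Finset (Fin N))
    (hSr : ∀ i ∈ Sr, eStar + ε ≤ siteEnergy lennardJones y i) (hole : Fin N → E3)
    (hnear : ∀ i ∈ Sh, dist (y i) (hole i) ≤ R) (hfar : ∀ i ∈ Sh, ∀ k, (1 : ℝ) / 2 ≤ dist (hole i) (y k))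
    (hfield : ∀ i ∈ Sh, holeField y (hole i) ≤ eStar - ε) :
    ε * ((Sr.card : ℝ) + Sh.card) ≤
      ((32 / 5 : ℝ) ^ 3 + (6 * R + 32 / 5) ^ 3) * (interactionEnergy lennardJones y - (N : ℝ) * eStar) := by
  have h3 : (0 : ℝ) < 1 / 3 := by norm_num
  have hr := card_allRattlers_le_excess h3 hsep Sr hSr
  have hh := card_allNearHoles_le_excess h3 hR hsep Sh hole hnear hfar hfield
  have e1 : (2 * (9 / 10) / (1 / 3 : ℝ) + 1) = 32 / 5 := by norm_num
  have e2 : (2 * (R + 9 / 10) / (1 / 3 : ℝ) + 1) = 6 * R + 32 / 5 := by ring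
  rw [e1] at hr
  rw [e2] at hh
  linarith

/-! ## §7 Certifiable membership (no `e*` needed for rattlers; holes need `e*` only through an upper bound `e(B)`)

A census cannot evaluate `e*`, but `e* ≤ e(B)` for every periodic `B` (`eStar_le`).  Hence `u_y(i) ≥ e(B) + ε` CERTIFIES an
`ε`-rattler, while an `ε`-hole `φ ≤ e* − ε` is certified by `φ ≤ e_low − ε` for any PROVED lower bound `e_low ≤ e*` — the
one place where the gross side meets the value of `e*`; the pricing theorems above never do. -/

/-- A site bound by less than `|e(B)| − ε` for some periodic `B` is an `ε`-rattler. -/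
theorem rattler_of_periodic_witness {y : Fin N → E3} {i : Fin N} {ε : ℝ} (B : PeriodicConfiguration 3)
    (h : B.energyPerParticle lennardJones + ε ≤ siteEnergy lennardJones y i) :
    eStar + ε ≤ siteEnergy lennardJones y i := by
  have := Summit.AtomisticToContinuum.Crystallization.Theorems.ChargedEnergyGapNegative.eStar_le B
  linarith

end Summit.AtomisticToContinuum.Crystallization.Theorems.ChargedEnergyGapGrossSurgery

end
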